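import Summits.ResolutionOfSingularities.ResolutionOfSingularities.Theorems.WildQuotientsGaloisReductionPerfectSqueeze
import Summits.ResolutionOfSingularities.ResolutionOfSingularities.Theorems.WildQuotientsSummitReductionPerfectSqueeze
import HarnessLib

/-!
# `WildQuotients.GaloisReduction` (stmt-ResolutionOfSingularities-15641): the PERFECT SQUEEZE —
# de Jong's Galois alteration is needed only for normal projective varieties over perfect fields

Route `ResolutionOfSingularities/WildQuotients`, support item `GaloisReduction`
(`:= WildQuotientResolution → Pialt`). The item is closed in tree modulo the named fact
`Literature.AlgebraicGeometry.Resolution.DeJong1997_galoisAlterationQuasiProjective` (de Jong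
1997, Thm. 5.13 / Cor. 5.15, over EVERY field and for EVERY integral separated finite-type `X`):
`Theorems.galoisReduction_of_deJong1997` (`…WildQuotientsGaloisReductionOfDeJong1997`).

This file proves the SQUEEZED conditional, with the same hypothesis — verbatim — as the sibling
crux's `Theorems.summitReduction_of_forall_perfectField_galoisAlteration`
(`…WildQuotientsSummitReductionPerfectSqueeze`): it suffices to have de Jong's Galois alteration
(regular integral quasi-projective source, faithful finite group `G`, `K(X) ⊂ K(X₁)^G` purely
inseparable) for NORMAL PROJECTIVE integral varieties over PERFECT fields of characteristic `p`.
So ONE discharge of that statement (the registered stub `stub_deJong1997_galoisAlteration_perfect`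
of crux `SummitReduction`, stmt-16324, taken over all primes) closes both items at once; and the
discharger may even work in TEXTBOOK form (`X₁` regular PROJECTIVE over `k`, `G` not necessarily
faithful: `galoisReduction_of_forall_perfectField_galoisAlterationProjective`).

Chain at a prime `p` (`pialtAt_of_galoisAlterationPerfectAt`), all ingredients proved in tree:

1. `pialtAt_of_pialtPerfectNormalProjectiveAt` (`…GaloisReductionPerfectSqueeze`, from
   `stub_pialtOfPerfect` — descent of purely inseparable regular alterations from the perfect
   closure — and `pialtConclusion_of_forall_normal_isProjectiveOver` — Chow + normalisation);
2. `pialtPerfectNormalProjectiveAt_of_galoisQuotientAlterationAt` — a Galois-type quotient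
   presentation `X′ → X₁ = X′/G → X` plus `WQ_p` gives PIAlt for `X` (resolve `X₁`, compose:
   purely inseparable alterations compose, de Jong 1996, 2.20);
3. `galoisQuotientAlterationAt_of_deJong` — the quotient presentation from de Jong's Galois
   alteration at `(k, X)` (SGA 1, V §1–2; Mumford AV §7; proved in tree).

Results:

* `pialtAt_of_galoisAlterationPerfectAt` — `DeJongPerfect_p → WQ_p → PIAlt_p` (every field of
  characteristic `p`, every integral separated finite-type `X`);
* `galoisReduction_of_forall_perfectField_galoisAlteration` — the item, conditional on de Jong's
  theorem for normal projective varieties over perfect fields only (hypothesis verbatim that of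
  `summitReduction_of_forall_perfectField_galoisAlteration`);
* `pialtAt_of_galoisAlterationPerfectAt'` — the same without the faithfulness clause;
* `pialtAt_of_galoisAlterationPerfectProjectiveAt`,
  `galoisReduction_of_forall_perfectField_galoisAlterationProjective` — the same with the residual
  hypothesis in textbook form (de Jong 1996, Thm. 7.3, over a perfect instead of an algebraically
  closed field): `X₁` regular integral PROJECTIVE over `k`, `G` finite acting, `π` a `G`-invariant
  alteration, `K(X) ⊂ K(X₁)^G` purely inseparable.

Everything here is proved; the file is CONDITIONAL only through the explicit hypotheses of its
theorems (no named fact is used as an axiom).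
-/

-- single-problem summit: the doubled namespace component `ResolutionOfSingularities` is forced
set_option linter.dupNamespace false

noncomputable section

open CategoryTheory CategoryTheory.Limits AlgebraicGeometry TopologicalSpace
open Literature.AlgebraicGeometry.Resolution
open Literature.AlgebraicGeometry.Motives (RatFn.functionFieldMap)
open Literature.AlgebraicGeometry

namespace Summit.ResolutionOfSingularities.ResolutionOfSingularities.Theorems

/-! ## Steps 1–4: the squeezed de Jong reduction at a prime -/

/-- **De Jong's reduction at a prime `p`, squeezed**: if every NORMAL PROJECTIVE integral variety
over every PERFECT field of characteristic `p` admits de Jong's Galois alteration `(X₁, G, π)`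
(regular integral quasi-projective source — finite subsets in affine opens —, faithful `G`,
`G`-invariant alteration `π`, `K(X) ⊂ K(X₁)^G` purely inseparable: de Jong 1997, Thm. 5.13 /
Cor. 5.15), then `WQ_p → PIAlt_p` — over EVERY field of characteristic `p` and for EVERY integral
separated finite-type `X`. Steps: perfect closure and descent
(`pialtAt_of_pialtPerfectNormalProjectiveAt`), quotient presentation
(`galoisQuotientAlterationAt_of_deJong`), resolution of the quotient by `WQ_p` and composition
(`pialtPerfectNormalProjectiveAt_of_galoisQuotientAlterationAt`).
[cite: DeJong1997, Thm. 5.13, Cor. 5.15, pp. 619–620] [cite: AbramovichOort2000, Cor. 2.9] -/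
theorem pialtAt_of_galoisAlterationPerfectAt (p : ℕ) (hp : p.Prime)
    (hdJ : ∀ (k : Type) [Field k] [CharP k p] [PerfectField k]
      (X : Scheme.{0}) [IsIntegral X] (f : X ⟶ Spec (.of k)),
      IsSeparated f → LocallyOfFiniteType f → QuasiCompact f →
      (∀ x : X, IsIntegrallyClosed (X.presheaf.stalk x)) → Motives.IsProjectiveOver (Over.mk f) →
      ∃ (G : Type) (_ : Group G) (_ : Finite G) (X₁ : Scheme.{0}) (_ : IsIntegral X₁)
        (ρ : G →* Aut X₁) (π : X₁ ⟶ X) (_ : IsDominant π),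
        IsAlteration π ∧ Scheme.IsRegular X₁ ∧ Function.Injective ρ ∧
        (∀ g : G, (ρ g).hom ≫ π = π) ∧
        (∀ S : Finset X₁, ∃ U : X₁.Opens, IsAffineOpen U ∧ (↑S : Set X₁) ⊆ U) ∧
        (∀ a : X₁.functionField, (∀ g : G, RatFn.functionFieldMap (ρ g).hom a = a) →
          ∃ n : ℕ, a ^ ringExpChar X.functionField ^ n ∈ Set.range (RatFn.functionFieldMap π)))
    (hWQ : ∀ (k : Type) [Field k] [CharP k p] (X' X₁ : Scheme.{0}) (f : X₁ ⟶ Spec (.of k))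
      (q : X' ⟶ X₁) (G : Type) [Group G] [Finite G] (ρ : G →* Aut X'),
      IsSeparated f → LocallyOfFiniteType f → QuasiCompact f → IsIntegral X₁ → IsIntegral X' →
      Scheme.IsRegular X' → IsFinite q → Function.Surjective q.base →
      (∃ U : X₁.Opens, Dense (U : Set X₁) ∧ Etale (q ∣_ U)) → (∀ g : G, (ρ g).hom ≫ q = q) →
      (∀ x y : X', q.base x = q.base y → ∃ g : G, (ρ g).hom.base x = y) →
      Scheme.HasResolution X₁)
    (k : Type) [Field k] [CharP k p] (X : Scheme.{0}) (f : X ⟶ Spec (.of k))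
    (hs : IsSeparated f) (hl : LocallyOfFiniteType f) (hq : QuasiCompact f) (hi : IsIntegral X) :
    ∃ (X' : Scheme.{0}) (g : X' ⟶ X), IsProper g ∧ IsIntegral X' ∧ Scheme.IsRegular X' ∧
      Function.Surjective g.base ∧
      ∃ U : X.Opens, Dense (U : Set X) ∧ IsFinite (g ∣_ U) ∧ UniversallyInjective (g ∣_ U) := by
  refine pialtAt_of_pialtPerfectNormalProjectiveAt p hp ?_ k X f hs hl hq hi
  intro K _ _ _ Y g hiY hproj hN
  refine pialtPerfectNormalProjectiveAt_of_galoisQuotientAlterationAt (p := p) ?_ hWQ K Y g hiY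
    hproj hN
  intro k' _ _ _ X' f' hs' hl' hq' hi' hN' hproj'
  haveI := hs'; haveI := hl'; haveI := hq'; haveI := hi'
  exact galoisQuotientAlterationAt_of_deJong hp X' f' (hdJ k' X' f' hs' hl' hq' hN' hproj')

/-! ## The item, squeezed -/

/-- **`GaloisReduction` (stmt-ResolutionOfSingularities-15641) from de Jong's Galois alteration
theorem for normal projective varieties over perfect fields** (the perfect squeeze of
`galoisReduction_of_deJong1997`): if for every prime `p`, every perfect field `k` of
characteristic `p` and every normal projective integral `X/k` there is a Galois alteration
`(X₁, G, π)` with `X₁` regular integral and quasi-projective (finite subsets in affine opens), `G`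
faithful and `K(X) ⊂ K(X₁)^G` purely inseparable (de Jong 1997, Thm. 5.13 / Cor. 5.15; de Jong
1996, Thm. 7.3; Abramovich–Oort 2000, Thm. 2.8), then `WildQuotientResolution → Pialt`. The
hypothesis is, verbatim, that of `summitReduction_of_forall_perfectField_galoisAlteration`.
[cite: DeJong1997, Thm. 5.13, Cor. 5.15] -/
theorem galoisReduction_of_forall_perfectField_galoisAlteration
    (hdJ : ∀ (p : ℕ), p.Prime → ∀ (k : Type) [Field k] [CharP k p] [PerfectField k]
      (X : Scheme.{0}) [IsIntegral X] (f : X ⟶ Spec (.of k)),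
      IsSeparated f → LocallyOfFiniteType f → QuasiCompact f →
      (∀ x : X, IsIntegrallyClosed (X.presheaf.stalk x)) → Motives.IsProjectiveOver (Over.mk f) →
      ∃ (G : Type) (_ : Group G) (_ : Finite G) (X₁ : Scheme.{0}) (_ : IsIntegral X₁)
        (ρ : G →* Aut X₁) (π : X₁ ⟶ X) (_ : IsDominant π),
        IsAlteration π ∧ Scheme.IsRegular X₁ ∧ Function.Injective ρ ∧
        (∀ g : G, (ρ g).hom ≫ π = π) ∧
        (∀ S : Finset X₁, ∃ U : X₁.Opens, IsAffineOpen U ∧ (↑S : Set X₁) ⊆ U) ∧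
        (∀ a : X₁.functionField, (∀ g : G, RatFn.functionFieldMap (ρ g).hom a = a) →
          ∃ n : ℕ, a ^ ringExpChar X.functionField ^ n ∈ Set.range (RatFn.functionFieldMap π))) :
    Theses.WildQuotients.GaloisReduction :=
  fun hWQ p hp k _ _ X f hs hl hq hi =>
    pialtAt_of_galoisAlterationPerfectAt p hp (fun k' _ _ _ X' _ f' => hdJ p hp k' X' f') (hWQ p hp)
      k X f hs hl hq hi

/-! ## The faithfulness clause is free -/

/-- **`DeJongPerfect_p` without faithfulness `→ WQ_p → PIAlt_p`**: the variant of
`pialtAt_of_galoisAlterationPerfectAt` whose de Jong hypothesis omits `Function.Injective ρ`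
(`galoisAlterationDatum_faithful`). [cite: DeJong1997, Thm. 5.13, Cor. 5.15] -/
theorem pialtAt_of_galoisAlterationPerfectAt' (p : ℕ) (hp : p.Prime)
    (hdJ : ∀ (k : Type) [Field k] [CharP k p] [PerfectField k]
      (X : Scheme.{0}) [IsIntegral X] (f : X ⟶ Spec (.of k)),
      IsSeparated f → LocallyOfFiniteType f → QuasiCompact f →
      (∀ x : X, IsIntegrallyClosed (X.presheaf.stalk x)) → Motives.IsProjectiveOver (Over.mk f) →
      ∃ (G : Type) (_ : Group G) (_ : Finite G) (X₁ : Scheme.{0}) (_ : IsIntegral X₁)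
        (ρ : G →* Aut X₁) (π : X₁ ⟶ X) (_ : IsDominant π),
        IsAlteration π ∧ Scheme.IsRegular X₁ ∧
        (∀ g : G, (ρ g).hom ≫ π = π) ∧
        (∀ S : Finset X₁, ∃ U : X₁.Opens, IsAffineOpen U ∧ (↑S : Set X₁) ⊆ U) ∧
        (∀ a : X₁.functionField, (∀ g : G, RatFn.functionFieldMap (ρ g).hom a = a) →
          ∃ n : ℕ, a ^ ringExpChar X.functionField ^ n ∈ Set.range (RatFn.functionFieldMap π)))
    (hWQ : ∀ (k : Type) [Field k] [CharP k p] (X' X₁ : Scheme.{0}) (f : X₁ ⟶ Spec (.of k))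
      (q : X' ⟶ X₁) (G : Type) [Group G] [Finite G] (ρ : G →* Aut X'),
      IsSeparated f → LocallyOfFiniteType f → QuasiCompact f → IsIntegral X₁ → IsIntegral X' →
      Scheme.IsRegular X' → IsFinite q → Function.Surjective q.base →
      (∃ U : X₁.Opens, Dense (U : Set X₁) ∧ Etale (q ∣_ U)) → (∀ g : G, (ρ g).hom ≫ q = q) →
      (∀ x y : X', q.base x = q.base y → ∃ g : G, (ρ g).hom.base x = y) →
      Scheme.HasResolution X₁)
    (k : Type) [Field k] [CharP k p] (X : Scheme.{0}) (f : X ⟶ Spec (.of k))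
    (hs : IsSeparated f) (hl : LocallyOfFiniteType f) (hq : QuasiCompact f) (hi : IsIntegral X) :
    ∃ (X' : Scheme.{0}) (g : X' ⟶ X), IsProper g ∧ IsIntegral X' ∧ Scheme.IsRegular X' ∧
      Function.Surjective g.base ∧
      ∃ U : X.Opens, Dense (U : Set X) ∧ IsFinite (g ∣_ U) ∧ UniversallyInjective (g ∣_ U) :=
  pialtAt_of_galoisAlterationPerfectAt p hp
    (fun k _ _ _ X _ f hs' hl' hq' hN hproj =>
      galoisAlterationDatum_faithful (hdJ k X f hs' hl' hq' hN hproj))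
    hWQ k X f hs hl hq hi

/-! ## The textbook form of the residual hypothesis: `X₁` regular PROJECTIVE over `k` -/

/-- **`DeJongPerfectProjective_p → WQ_p → PIAlt_p`** — the squeezed de Jong reduction at a prime
with the residual hypothesis in TEXTBOOK form: for every perfect field `k` of characteristic `p`
and every normal projective integral `X/k`, a finite group `G` acting on a REGULAR integral `X₁`
PROJECTIVE over `k`, a `G`-invariant alteration `π : X₁ → X`, and `K(X) ⊂ K(X₁)^G` purely
inseparable (de Jong 1996, Thm. 7.3, stated there over algebraically closed `k`; de Jong 1997,
Thm. 5.13 / Cor. 5.15 over any field). [cite: DeJong1996, Thm. 7.3, p. 88]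
[cite: DeJong1997, Thm. 5.13, Cor. 5.15] -/
theorem pialtAt_of_galoisAlterationPerfectProjectiveAt (p : ℕ) (hp : p.Prime)
    (hdJ : ∀ (k : Type) [Field k] [CharP k p] [PerfectField k]
      (X : Scheme.{0}) [IsIntegral X] (f : X ⟶ Spec (.of k)),
      IsSeparated f → LocallyOfFiniteType f → QuasiCompact f →
      (∀ x : X, IsIntegrallyClosed (X.presheaf.stalk x)) → Motives.IsProjectiveOver (Over.mk f) →
      ∃ (G : Type) (_ : Group G) (_ : Finite G) (X₁ : Scheme.{0}) (_ : IsIntegral X₁)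
        (ρ : G →* Aut X₁) (π : X₁ ⟶ X) (_ : IsDominant π),
        IsAlteration π ∧ Scheme.IsRegular X₁ ∧ (∀ g : G, (ρ g).hom ≫ π = π) ∧
        Motives.IsProjectiveOver (Over.mk (π ≫ f)) ∧
        (∀ a : X₁.functionField, (∀ g : G, RatFn.functionFieldMap (ρ g).hom a = a) →
          ∃ n : ℕ, a ^ ringExpChar X.functionField ^ n ∈ Set.range (RatFn.functionFieldMap π)))
    (hWQ : ∀ (k : Type) [Field k] [CharP k p] (X' X₁ : Scheme.{0}) (f : X₁ ⟶ Spec (.of k))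
      (q : X' ⟶ X₁) (G : Type) [Group G] [Finite G] (ρ : G →* Aut X'),
      IsSeparated f → LocallyOfFiniteType f → QuasiCompact f → IsIntegral X₁ → IsIntegral X' →
      Scheme.IsRegular X' → IsFinite q → Function.Surjective q.base →
      (∃ U : X₁.Opens, Dense (U : Set X₁) ∧ Etale (q ∣_ U)) → (∀ g : G, (ρ g).hom ≫ q = q) →
      (∀ x y : X', q.base x = q.base y → ∃ g : G, (ρ g).hom.base x = y) →
      Scheme.HasResolution X₁)
    (k : Type) [Field k] [CharP k p] (X : Scheme.{0}) (f : X ⟶ Spec (.of k))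
    (hs : IsSeparated f) (hl : LocallyOfFiniteType f) (hq : QuasiCompact f) (hi : IsIntegral X) :
    ∃ (X' : Scheme.{0}) (g : X' ⟶ X), IsProper g ∧ IsIntegral X' ∧ Scheme.IsRegular X' ∧
      Function.Surjective g.base ∧
      ∃ U : X.Opens, Dense (U : Set X) ∧ IsFinite (g ∣_ U) ∧ UniversallyInjective (g ∣_ U) :=
  pialtAt_of_galoisAlterationPerfectAt p hp
    (fun k _ _ _ X _ f hs' hl' hq' hN hproj =>
      galoisAlterationDatum_of_isProjectiveOver f (hdJ k X f hs' hl' hq' hN hproj))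
    hWQ k X f hs hl hq hi

/-- **`GaloisReduction` from de Jong's theorem in textbook form over perfect fields**: if for
every prime `p`, every perfect field `k` of characteristic `p` and every normal projective
integral `X/k` there are a finite group `G` acting on a regular integral `X₁` projective over `k`
and a `G`-invariant alteration `π : X₁ → X` with `K(X) ⊂ K(X₁)^G` purely inseparable (de Jong
1996, Thm. 7.3; de Jong 1997, Thm. 5.13 / Cor. 5.15), then `WildQuotientResolution → Pialt`.
[cite: DeJong1996, Thm. 7.3, p. 88] [cite: DeJong1997, Thm. 5.13, Cor. 5.15] -/
theorem galoisReduction_of_forall_perfectField_galoisAlterationProjective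
    (hdJ : ∀ (p : ℕ), p.Prime → ∀ (k : Type) [Field k] [CharP k p] [PerfectField k]
      (X : Scheme.{0}) [IsIntegral X] (f : X ⟶ Spec (.of k)),
      IsSeparated f → LocallyOfFiniteType f → QuasiCompact f →
      (∀ x : X, IsIntegrallyClosed (X.presheaf.stalk x)) → Motives.IsProjectiveOver (Over.mk f) →
      ∃ (G : Type) (_ : Group G) (_ : Finite G) (X₁ : Scheme.{0}) (_ : IsIntegral X₁)
        (ρ : G →* Aut X₁) (π : X₁ ⟶ X) (_ : IsDominant π),
        IsAlteration π ∧ Scheme.IsRegular X₁ ∧ (∀ g : G, (ρ g).hom ≫ π = π) ∧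
        Motives.IsProjectiveOver (Over.mk (π ≫ f)) ∧
        (∀ a : X₁.functionField, (∀ g : G, RatFn.functionFieldMap (ρ g).hom a = a) →
          ∃ n : ℕ, a ^ ringExpChar X.functionField ^ n ∈ Set.range (RatFn.functionFieldMap π))) :
    Theses.WildQuotients.GaloisReduction :=
  fun hWQ p hp k _ _ X f hs hl hq hi =>
    pialtAt_of_galoisAlterationPerfectProjectiveAt p hp (fun k' _ _ _ X' _ f' => hdJ p hp k' X' f')
      (hWQ p hp) k X f hs hl hq hi

end Summit.ResolutionOfSingularities.ResolutionOfSingularities.Theorems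

end
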